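import Literature.AlgebraicGeometry.Resolution.EmbeddedResolutionExcellentSurfacesResolutionCodim
import Literature.AlgebraicGeometry.Resolution.ResolutionProjectiveReduction
import Literature.AlgebraicGeometry.Resolution.ArithmeticalThreefolds
import HarnessLib

/-!
# CJS Thm. 1.2 over fields from CJS Thm. 1.4 (`B = ∅`), modulo a codimension-two re-embedding of `ℙⁿ_k`

Topic: `Literature/AlgebraicGeometry/Resolution` (proofs only: no new notions, no new named facts).

The named fact `CossartJannsenSaito2020` (`ArithmeticalThreefolds.lean`: resolution of reduced separated schemes of
finite type of dimension `≤ 2` over every field, CJS Thm. 1.2 in the weak form) is an input of Cossart–Piltant 2019's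
architecture (patching, Prop. 4.6; descent, Prop. 4.8).  By the tree's reduction `ResolutionOverUpToDim.of_projective`
(Chow's lemma, irreducible components, projective closure) it suffices to resolve the INTEGRAL CLOSED SUBSCHEMES OF
`ℙⁿ_k` of dimension `≤ 2`; and `CossartJannsenSaito2020Embedded.hasResolution_of_two_le_ringKrullDim`
(`EmbeddedResolutionExcellentSurfacesResolutionCodim.lean`) resolves every integral scheme of dimension `≤ 2` closed
in a Noetherian regular excellent scheme WITH CODIMENSION `≥ 2` at its generic point.  This file records the
resulting reduction:

* `cossartJannsenSaito2020_of_embedded_of_reembedding` — `CossartJannsenSaito2020Embedded` together with the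
  existence, for every `n` and `k`, of a closed immersion of `ℙⁿ_k` into SOME Noetherian regular excellent scheme
  all of whose local rings at points of the image have dimension `≥ 2` (e.g. a linear `ℙⁿ_k ↪ ℙⁿ⁺²_k`, or the zero
  section of `𝔸²` over `ℙⁿ_k`) implies `CossartJannsenSaito2020`.

The re-embedding hypothesis is elementary algebraic geometry but not yet in the tree; it is the one missing input
for keying ALL surface-resolution leaves of Cossart–Piltant's Thm. 1.1 on the embedded theorem (stub 1 of the
`CleanModels` crux of the summit `ResolutionOfSingularities`).

## Sources

* V. Cossart, U. Jannsen, S. Saito, LNM 2270 (2020), Thm. 1.2, Thm. 1.4. [CossartJannsenSaito2020]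
* V. Cossart, O. Piltant, J. Algebra 529 (2019), proof of Prop. 4.6 (arXiv v1: Prop. 4.4), Steps 1–3.
  [CossartPiltant2019]
-/

noncomputable section

open CategoryTheory AlgebraicGeometry TopologicalSpace

namespace Literature.AlgebraicGeometry.Resolution

universe u

/-- **CJS Thm. 1.2 over fields from Thm. 1.4 (`B = ∅`) and a codimension-two re-embedding of projective space.**
If every `ℙⁿ_k` admits a closed immersion `j` into a Noetherian regular excellent scheme `Z` with
`dim 𝒪_{Z, j(x)} ≥ 2` for all `x`, then `CossartJannsenSaito2020Embedded` implies `CossartJannsenSaito2020`: by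
`ResolutionOverUpToDim.of_projective` it suffices to resolve an integral `X` with a closed immersion `ι : X ↪ ℙⁿ_k`
and `dim X ≤ 2`, and `ι ≫ j : X ↪ Z` satisfies the hypotheses of
`CossartJannsenSaito2020Embedded.hasResolution_of_two_le_ringKrullDim`.
[cite: CossartJannsenSaito2020, Thm. 1.2 and Thm. 1.4] [cite: CossartPiltant2019, Prop. 4.6 (arXiv v1: Prop. 4.4), proof, Steps 1–3] -/
theorem cossartJannsenSaito2020_of_embedded_of_reembedding (hCJSE : CossartJannsenSaito2020Embedded.{u})
    (hP : ∀ (n : ℕ) (k : Type u) [Field k], ∃ (Z : Scheme.{u}) (j : (Motives.projectiveSpace n k).left ⟶ Z),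
      IsClosedImmersion j ∧ IsNoetherian Z ∧ Scheme.IsRegular Z ∧ Scheme.IsExcellent Z ∧
        ∀ x, (2 : WithBot ℕ∞) ≤ ringKrullDim (Z.presheaf.stalk (j x))) :
    CossartJannsenSaito2020.{u} := by
  intro k _
  refine ResolutionOverUpToDim.of_projective fun n X ι hι hint hdim => ?_
  obtain ⟨Z, j, hj, hZ, hreg, hexc, h2⟩ := hP n k
  haveI := hι
  haveI := hint
  haveI := hj
  haveI := hZ
  exact hCJSE.hasResolution_of_two_le_ringKrullDim (ι ≫ j) hreg hexc hdim
    (by rw [Scheme.Hom.comp_apply]; exact h2 (ι (genericPoint X)))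

end Literature.AlgebraicGeometry.Resolution

end
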